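import Summits.Ventures.Crystal3D.Bulk.SubtendedAngles
import HarnessLib

/-!
# Lemma 14.2 of the rattler prune: a HOLE side (length `ρ = arccos κ`) of a face, seen from a
# point at least `60°` from its shell end and at least `ρ` from the hole, subtends at most
# `α₀ = arccos (1/3)` — provided the two distances sum to at most `180° + ρ`

HONEST FRAMING. Part of the venture `Summits/Ventures/Crystal3D` (cell `pub-crystal3d`, phase 2;
seat p3), generic and configuration-free: `V` is any real inner product space; nothing here
mentions GAP(1.26). Companion of `Bulk/SubtendedAngles.lean` (Lemma 14.1, the `60°` sides) for
the two sides of a `p`-face at the hole (cell file `phase2/ENV-CENSUS/DESIGN-L12-THEORY.md`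
§P-L3 (d1)(d2), theory-2 §14.2). Theory-2 states the bound `A_x(ρ) = arccos (κ/(√3·√(1−κ²)))`
under `a + b ≤ U(ρ) ≈ 245°`; what the census assembly needs, and what is proved here, is the
weaker conclusion `≤ α₀` (note `A_x(ρ) ≤ α₀` for `κ ≥ 1/2`) under the hypothesis `a + b ≤ π + ρ`
that the inner-path rows (§14.3) supply for `p`-faces of size `≤ 5`:

* `cos_mul_cos_add_mul_sin_mul_sin` — `cos a cos b + c sin a sin b =
  ((1+c)/2) cos (a−b) + ((1−c)/2) cos (a+b)`; `cos_sin_comb_le` — `A cos θ + B sin θ` is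
  nondecreasing on `[0, θ₀]` when `A sin θ₀ ≤ B cos θ₀`; `hole_side_constants` — the numerics of
  `c_B = κ/(√3 σ)`, `σ = √(1−κ²)`, for `1/2 ≤ κ ≤ 7/10`;
* **`angle_perpTo_le_arccos_third_of_hole`** — unit `z, v, p`, `⟪v,p⟫ = κ` with
  `1/2 ≤ κ ≤ 7/10`, `⟪z,v⟫ ≤ 1/2`, `⟪z,p⟫ ≤ κ`, `∠(z,v) + ∠(z,p) ≤ π + arccos κ` ⇒
  `∠(perpTo z v, perpTo z p) ≤ arccos (1/3)`.

Proof: it suffices that `L := ((1+c_B)/2) cos (a−b) + ((1−c_B)/2) cos (a+b) ≤ κ`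
(then `cos ∠ ≥ c_B ≥ 1/3`). If `a + b ≥ 2π/3` then `cos (a+b) ≤ −1/2` and `L ≤ (1+3c_B)/4 ≤ κ`
by the polynomial inequality `3κ² ≤ (4κ−1)²(1−κ²) = (2κ−1)(6κ − 8κ³ − 1) + 3κ²`. If
`a + b < 2π/3`, put `θ = 2π/3 − (a+b) ∈ (0, π/3 − ρ]`; then `a − b ≥ θ`, so
`L ≤ F(θ) := ((1+3c_B)/4) cos θ + (√3/4)(1−c_B) sin θ`, and `F` is nondecreasing up to
`θ₀ = π/3 − ρ`, where `F(θ₀) = κ` exactly — the monotonicity input reducing to `κ² ≤ 1/2`.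
-/

noncomputable section

namespace Summit.Ventures.Crystal3D

open Literature.Geometry.DiscreteGeometry Real InnerProductGeometry Finset
open scoped InnerProductSpace

section Generic

variable {V : Type*} [NormedAddCommGroup V] [InnerProductSpace ℝ V]

/-- `cos a cos b + c sin a sin b = ((1+c)/2) cos (a−b) + ((1−c)/2) cos (a+b)`. -/
theorem cos_mul_cos_add_mul_sin_mul_sin (a b c : ℝ) :
    cos a * cos b + c * (sin a * sin b) =
      (1 + c) / 2 * cos (a - b) + (1 - c) / 2 * cos (a + b) := by
  rw [Real.cos_add, Real.cos_sub]; ring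

/-- The polynomial fact of CASE 1: `3κ² ≤ (4κ−1)²(1−κ²)` for `1/2 ≤ κ ≤ 7/10`. -/
theorem three_mul_sq_le_of_mem {κ : ℝ} (h1 : 1 / 2 ≤ κ) (h2 : κ ≤ 7 / 10) :
    3 * κ ^ 2 ≤ (4 * κ - 1) ^ 2 * (1 - κ ^ 2) := by
  -- `(4κ−1)²(1−κ²) − 3κ² = (2κ−1)(6κ − 8κ³ − 1)` and `6κ − 8κ³ − 1 > 0` on the interval
  have hk0 : 0 ≤ κ := by linarith
  have hk2 : κ ^ 2 ≤ 49 / 100 := by nlinarith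
  have hk3 : κ ^ 3 ≤ 49 / 100 * κ := by nlinarith [mul_le_mul_of_nonneg_right hk2 hk0]
  have hq : 0 ≤ 6 * κ - 8 * κ ^ 3 - 1 := by linarith
  have h21 : 0 ≤ 2 * κ - 1 := by linarith
  nlinarith [mul_nonneg h21 hq]

/-- **Monotone trigonometric combination.** If `A, B ≥ 0`, `0 ≤ θ ≤ θ₀ < π/2` and
`A sin θ₀ ≤ B cos θ₀`, then `A cos θ + B sin θ ≤ A cos θ₀ + B sin θ₀` (`A cos + B sin` increases
up to its maximum, which lies beyond `θ₀`). -/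
theorem cos_sin_comb_le {A B θ θ₀ : ℝ} (hA : 0 ≤ A) (hB : 0 ≤ B) (h0 : 0 ≤ θ) (hle : θ ≤ θ₀)
    (hθ₀ : θ₀ < π / 2) (hkey : A * sin θ₀ ≤ B * cos θ₀) :
    A * cos θ + B * sin θ ≤ A * cos θ₀ + B * sin θ₀ := by
  have hc := Real.cos_sub_cos θ₀ θ
  have hs := Real.sin_sub_sin θ₀ θ
  set ψ := (θ₀ + θ) / 2 with hψ
  set δ := (θ₀ - θ) / 2 with hδ
  have hδ0 : 0 ≤ sin δ := Real.sin_nonneg_of_nonneg_of_le_pi (by rw [hδ]; linarith)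
    (by rw [hδ]; linarith [Real.pi_pos])
  have hψ0 : 0 ≤ ψ := by rw [hψ]; linarith
  have hψ1 : ψ ≤ θ₀ := by rw [hψ]; linarith
  have hsinψ : sin ψ ≤ sin θ₀ :=
    Real.sin_le_sin_of_le_of_le_pi_div_two (by linarith [Real.pi_pos]) hθ₀.le hψ1
  have hcosψ : cos θ₀ ≤ cos ψ :=
    Real.cos_le_cos_of_nonneg_of_le_pi hψ0 (by linarith) hψ1
  have hsin0 : 0 ≤ sin ψ := Real.sin_nonneg_of_nonneg_of_le_pi hψ0 (by linarith)
  have hcos0 : 0 ≤ cos θ₀ := Real.cos_nonneg_of_mem_Icc ⟨by linarith, hθ₀.le⟩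
  have hbr : 0 ≤ B * cos ψ - A * sin ψ := by
    nlinarith [mul_le_mul_of_nonneg_left hsinψ hA, mul_le_mul_of_nonneg_left hcosψ hB]
  have e : A * cos θ₀ + B * sin θ₀ - (A * cos θ + B * sin θ) =
      2 * sin δ * (B * cos ψ - A * sin ψ) := by
    have e1 : A * cos θ₀ + B * sin θ₀ - (A * cos θ + B * sin θ) =
        A * (cos θ₀ - cos θ) + B * (sin θ₀ - sin θ) := by ring
    rw [e1, hc, hs]; ring
  nlinarith [mul_nonneg hδ0 hbr, e]

/-- **The constants of a hole side.** For `1/2 ≤ κ ≤ 7/10`, with `σ = √(1−κ²)` and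
`c_B = κ/(√3 σ)`: `σ > 0`; `1/3 ≤ c_B ≤ 1`; `c_B ≤ (4κ−1)/3` (CASE 1); `c_B · √3 σ = κ`; and the
CASE 2 monotonicity input `(1+3c_B)/4 · (√3 κ/2 − σ/2) ≤ (√3/4)(1 − c_B)(κ/2 + √3 σ/2)`. -/
theorem hole_side_constants {κ : ℝ} (h1 : 1 / 2 ≤ κ) (h2 : κ ≤ 7 / 10) :
    0 < Real.sqrt (1 - κ ^ 2) ∧
      1 / 3 ≤ κ / (Real.sqrt 3 * Real.sqrt (1 - κ ^ 2)) ∧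
      κ / (Real.sqrt 3 * Real.sqrt (1 - κ ^ 2)) ≤ 1 ∧
      κ / (Real.sqrt 3 * Real.sqrt (1 - κ ^ 2)) ≤ (4 * κ - 1) / 3 ∧
      κ / (Real.sqrt 3 * Real.sqrt (1 - κ ^ 2)) * (Real.sqrt 3 * Real.sqrt (1 - κ ^ 2)) = κ ∧
      (1 + 3 * (κ / (Real.sqrt 3 * Real.sqrt (1 - κ ^ 2)))) / 4 *
          (Real.sqrt 3 / 2 * κ - Real.sqrt (1 - κ ^ 2) / 2) ≤
        Real.sqrt 3 / 4 * (1 - κ / (Real.sqrt 3 * Real.sqrt (1 - κ ^ 2))) *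
          (κ / 2 + Real.sqrt 3 / 2 * Real.sqrt (1 - κ ^ 2)) := by
  set σ := Real.sqrt (1 - κ ^ 2) with hσ
  have hκsq : κ ^ 2 ≤ 49 / 100 := by nlinarith
  have hσ2 : σ ^ 2 = 1 - κ ^ 2 := Real.sq_sqrt (by nlinarith)
  have hσpos : 0 < σ := Real.sqrt_pos.2 (by nlinarith)
  have h3 : Real.sqrt 3 ^ 2 = 3 := Real.sq_sqrt (by norm_num)
  have h33 : Real.sqrt 3 * Real.sqrt 3 = 3 := by rw [← sq, h3]
  have h3pos : 0 < Real.sqrt 3 := Real.sqrt_pos.2 (by norm_num)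
  set t := Real.sqrt 3 * σ with ht
  have htpos : 0 < t := mul_pos h3pos hσpos
  have ht2 : t ^ 2 = 3 * (1 - κ ^ 2) := by rw [ht, mul_pow, h3, hσ2]
  have hcBt : κ / t * t = κ := div_mul_cancel₀ _ htpos.ne'
  set cB := κ / t with hcB
  have hcB0 : 0 ≤ cB := div_nonneg (by linarith) htpos.le
  refine ⟨hσpos, ?_, ?_, ?_, hcBt, ?_⟩
  · rw [hcB, le_div_iff₀ htpos]
    nlinarith [sq_nonneg (t - 3 * κ), sq_nonneg (t + 3 * κ)]
  · rw [hcB, div_le_one htpos]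
    nlinarith [sq_nonneg (t - κ)]
  · rw [hcB, div_le_iff₀ htpos]
    have hpoly := three_mul_sq_le_of_mem h1 h2
    have hnn : 0 ≤ (4 * κ - 1) / 3 * t := mul_nonneg (by linarith) htpos.le
    nlinarith [sq_nonneg ((4 * κ - 1) / 3 * t - κ), sq_nonneg ((4 * κ - 1) / 3 * t + κ)]
  · -- the difference is `σ/2 − (√3/2) c_B κ = (σ² − κ²)/(2σ) ≥ 0`
    have e : Real.sqrt 3 / 4 * (1 - cB) * (κ / 2 + Real.sqrt 3 / 2 * σ) -
        (1 + 3 * cB) / 4 * (Real.sqrt 3 / 2 * κ - σ / 2) = σ / 2 - Real.sqrt 3 / 2 * cB * κ := by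
      linear_combination ((1 - cB) * σ / 8) * h33
    have hk : Real.sqrt 3 * cB * κ * σ = κ ^ 2 := by
      calc Real.sqrt 3 * cB * κ * σ = (cB * t) * κ := by rw [ht]; ring
        _ = κ ^ 2 := by rw [hcBt]; ring
    have hgoal : 0 ≤ σ / 2 - Real.sqrt 3 / 2 * cB * κ := by
      -- multiply by `σ > 0`
      have : 0 ≤ (σ / 2 - Real.sqrt 3 / 2 * cB * κ) * σ := by nlinarith [hk, hσ2]
      by_contra hneg
      exact absurd this (not_le.2 (mul_neg_of_neg_of_pos (not_le.1 hneg) hσpos))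
    linarith

/-- **Lemma 14.2 (hole sides).** Unit vectors `z, v, p` with `⟪v,p⟫ = κ`, `1/2 ≤ κ ≤ 7/10` (a
side of length `ρ = arccos κ` at the hole), `⟪z,v⟫ ≤ 1/2` (the point is `≥ 60°` from the shell
end), `⟪z,p⟫ ≤ κ` (`≥ ρ` from the hole) and `∠(z,v) + ∠(z,p) ≤ π + ρ`: the angle subtended at
`z` by the side `vp` is at most `α₀ = arccos (1/3)`. -/
theorem angle_perpTo_le_arccos_third_of_hole {z v p : V} (hz : ‖z‖ = 1) (hv : ‖v‖ = 1)
    (hp : ‖p‖ = 1) {κ : ℝ} (hκ1 : 1 / 2 ≤ κ) (hκ2 : κ ≤ 7 / 10) (hvp : ⟪v, p⟫_ℝ = κ)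
    (hzv : ⟪z, v⟫_ℝ ≤ 1 / 2) (hzp : ⟪z, p⟫_ℝ ≤ κ)
    (hsum : angle z v + angle z p ≤ π + arccos κ) :
    angle (perpTo z v) (perpTo z p) ≤ arccos (1 / 3) := by
  obtain ⟨hσpos, hcB3, hcB1, hcBle, hcBσ, hkey2⟩ := hole_side_constants hκ1 hκ2
  set σ := Real.sqrt (1 - κ ^ 2) with hσ
  set cB := κ / (Real.sqrt 3 * σ) with hcB
  set x := ⟪z, v⟫_ℝ with hx
  set y := ⟪z, p⟫_ℝ with hy
  have hρsin : sin (arccos κ) = σ := Real.sin_arccos κ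
  clear_value σ cB
  have hcB0 : 0 ≤ cB := le_trans (by norm_num) hcB3
  have hρdef : cos (arccos κ) = κ := Real.cos_arccos (by linarith) (by linarith)
  have hρ3 : arccos κ ≤ π / 3 := by
    rw [← Real.arccos_cos (by positivity : (0 : ℝ) ≤ π / 3) (by linarith [Real.pi_pos]),
      Real.cos_pi_div_three]
    exact Real.arccos_le_arccos hκ1
  have hρ0 : 0 ≤ arccos κ := Real.arccos_nonneg κ
  -- the distances
  have hav : angle z v = arccos x := angle_eq_arccos_inner_of_norm_one hz hv
  have haw : angle z p = arccos y := angle_eq_arccos_inner_of_norm_one hz hp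
  have hx1 : -1 ≤ x := by
    have := abs_real_inner_le_norm z v; rw [hz, hv, mul_one] at this; exact (abs_le.1 this).1
  have hy1 : -1 ≤ y := by
    have := abs_real_inner_le_norm z p; rw [hz, hp, mul_one] at this; exact (abs_le.1 this).1
  have hin : ⟪perpTo z v, perpTo z p⟫_ℝ = κ - x * y := by
    rw [inner_perpTo_perpTo_of_norm_eq_one hz, hvp]
  have hnv : ‖perpTo z v‖ = Real.sqrt (1 - x ^ 2) := by
    rw [← Real.sqrt_sq (norm_nonneg _), norm_perpTo_sq_of_norm_eq_one hz hv]
  have hnw : ‖perpTo z p‖ = Real.sqrt (1 - y ^ 2) := by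
    rw [← Real.sqrt_sq (norm_nonneg _), norm_perpTo_sq_of_norm_eq_one hz hp]
  have ha3 : π / 3 ≤ arccos x := hav ▸ pi_div_three_le_angle_of_inner_le_half hz hv hzv
  have hbρ : arccos κ ≤ arccos y := Real.arccos_le_arccos hzp
  have haπ : arccos x ≤ π := Real.arccos_le_pi x
  have hbπ : arccos y ≤ π := Real.arccos_le_pi y
  rw [hav, haw] at hsum
  have hcx : cos (arccos x) = x := Real.cos_arccos hx1 (by linarith)
  have hcy : cos (arccos y) = y := Real.cos_arccos hy1 (by linarith)
  have hsx : sin (arccos x) = Real.sqrt (1 - x ^ 2) := Real.sin_arccos x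
  have hsy : sin (arccos y) = Real.sqrt (1 - y ^ 2) := Real.sin_arccos y
  -- THE KEY BOUND: `x y + c_B √(1−x²) √(1−y²) ≤ κ`
  have key : x * y + cB * (Real.sqrt (1 - x ^ 2) * Real.sqrt (1 - y ^ 2)) ≤ κ := by
    set a := arccos x with ha
    set b := arccos y with hb
    have hconv : x * y + cB * (Real.sqrt (1 - x ^ 2) * Real.sqrt (1 - y ^ 2)) =
        cos a * cos b + cB * (sin a * sin b) := by rw [hcx, hcy, hsx, hsy]
    rw [hconv, cos_mul_cos_add_mul_sin_mul_sin]
    have hS0 : 0 ≤ (1 - cB) / 2 := by linarith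
    have hS1 : 0 ≤ (1 + cB) / 2 := by linarith
    by_cases hcase : 2 * π / 3 ≤ a + b
    · -- CASE 1
      have h1 : cos (a + b) ≤ -(1 / 2) := cos_le_neg_half_of_mem hcase (by linarith)
      have h2 : cos (a - b) ≤ 1 := Real.cos_le_one _
      linarith [mul_le_mul_of_nonneg_left h2 hS1, mul_le_mul_of_nonneg_left h1 hS0]
    · -- CASE 2: `θ = 2π/3 − (a+b) ∈ (0, π/3 − ρ]`, `a − b ≥ θ`
      push Not at hcase
      set θ := 2 * π / 3 - (a + b) with hθ
      set θ₀ := π / 3 - arccos κ with hθ₀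
      have hθ0 : 0 ≤ θ := by rw [hθ]; linarith
      have hθle : θ ≤ θ₀ := by rw [hθ, hθ₀]; linarith
      have hθ₀2 : θ₀ < π / 2 := by rw [hθ₀]; linarith [Real.pi_pos]
      have hab1 : θ ≤ a - b := by rw [hθ]; linarith
      have hab2 : a - b ≤ π := by linarith [Real.arccos_nonneg y]
      have hcosab : cos (a - b) ≤ cos θ := Real.cos_le_cos_of_nonneg_of_le_pi hθ0 hab2 hab1
      have hcoss : cos (a + b) = -(1 / 2) * cos θ + Real.sqrt 3 / 2 * sin θ := by
        rw [show a + b = 2 * π / 3 - θ by rw [hθ]; ring, Real.cos_sub,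
          show 2 * π / 3 = π - π / 3 by ring, Real.cos_pi_sub, Real.sin_pi_sub,
          Real.cos_pi_div_three, Real.sin_pi_div_three]
      -- `L ≤ F θ`
      have hF : (1 + cB) / 2 * cos (a - b) + (1 - cB) / 2 * cos (a + b) ≤
          (1 + 3 * cB) / 4 * cos θ + Real.sqrt 3 / 4 * (1 - cB) * sin θ := by
        rw [hcoss]
        have := mul_le_mul_of_nonneg_left hcosab hS1
        linarith
      -- `F θ ≤ F θ₀ = κ`
      have hcθ₀ : cos θ₀ = κ / 2 + Real.sqrt 3 / 2 * σ := by
        rw [hθ₀, Real.cos_sub, Real.cos_pi_div_three, Real.sin_pi_div_three, hρdef, hρsin]; ring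
      have hsθ₀ : sin θ₀ = Real.sqrt 3 / 2 * κ - σ / 2 := by
        rw [hθ₀, Real.sin_sub, Real.cos_pi_div_three, Real.sin_pi_div_three, hρdef, hρsin]; ring
      have hAnn : 0 ≤ (1 + 3 * cB) / 4 := by linarith
      have hBnn : 0 ≤ Real.sqrt 3 / 4 * (1 - cB) :=
        mul_nonneg (by positivity) (by linarith)
      have hmono := cos_sin_comb_le hAnn hBnn hθ0 hθle hθ₀2 (by rw [hcθ₀, hsθ₀]; exact hkey2)
      have h33 : Real.sqrt 3 * Real.sqrt 3 = 3 := Real.mul_self_sqrt (by norm_num)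
      have hFθ₀ : (1 + 3 * cB) / 4 * cos θ₀ + Real.sqrt 3 / 4 * (1 - cB) * sin θ₀ = κ := by
        rw [hcθ₀, hsθ₀]
        linear_combination (1 / 2) * hcBσ + ((1 - cB) * κ / 8) * h33
      linarith
  -- non-degeneracy: `x, y > −1`
  have hx1' : -1 < x := by
    rcases hx1.eq_or_lt with h | h
    · exfalso
      have hpv : perpTo z v = 0 := by rw [← norm_eq_zero, hnv, ← h]; norm_num
      have h0 : κ - x * y = 0 := by rw [← hin, hpv, inner_zero_left]
      have ha : arccos x = π := by rw [← h, Real.arccos_neg_one]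
      have hb : arccos y ≤ arccos κ := by linarith
      have hyκ : κ ≤ y := by
        have := Real.cos_le_cos_of_nonneg_of_le_pi (Real.arccos_nonneg y) (Real.arccos_le_pi κ) hb
        rwa [hρdef, hcy] at this
      rw [← h] at h0
      linarith
    · exact h
  have hy1' : -1 < y := by
    rcases hy1.eq_or_lt with h | h
    · exfalso
      have hpw : perpTo z p = 0 := by rw [← norm_eq_zero, hnw, ← h]; norm_num
      have h0 : κ - x * y = 0 := by rw [← hin, hpw, inner_zero_right]
      have hb : arccos y = π := by rw [← h, Real.arccos_neg_one]
      have ha : arccos x ≤ arccos κ := by linarith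
      have hxκ : κ ≤ x := by
        have := Real.cos_le_cos_of_nonneg_of_le_pi (Real.arccos_nonneg x) (Real.arccos_le_pi κ) ha
        rwa [hρdef, hcx] at this
      rw [← h] at h0
      linarith
    · exact h
  have hxlt : x < 1 := by linarith
  have hylt : y < 1 := by linarith
  have hpx : 0 < 1 - x ^ 2 := by
    have h := mul_pos (show (0 : ℝ) < 1 - x by linarith) (show (0 : ℝ) < 1 + x by linarith)
    linarith [show (1 - x) * (1 + x) = 1 - x ^ 2 by ring]
  have hpy : 0 < 1 - y ^ 2 := by
    have h := mul_pos (show (0 : ℝ) < 1 - y by linarith) (show (0 : ℝ) < 1 + y by linarith)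
    linarith [show (1 - y) * (1 + y) = 1 - y ^ 2 by ring]
  have hsvx : 0 < Real.sqrt (1 - x ^ 2) := Real.sqrt_pos.2 hpx
  have hsvy : 0 < Real.sqrt (1 - y ^ 2) := Real.sqrt_pos.2 hpy
  -- `cos` of the subtended angle is `≥ c_B ≥ 1/3`
  have hcos : (1 : ℝ) / 3 ≤ ⟪perpTo z v, perpTo z p⟫_ℝ / (‖perpTo z v‖ * ‖perpTo z p‖) := by
    rw [hin, hnv, hnw, le_div_iff₀ (mul_pos hsvx hsvy)]
    have hprod : 0 ≤ Real.sqrt (1 - x ^ 2) * Real.sqrt (1 - y ^ 2) := by positivity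
    linarith [mul_le_mul_of_nonneg_right hcB3 hprod]
  unfold angle
  exact Real.arccos_le_arccos hcos

end Generic

end Summit.Ventures.Crystal3D
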